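import Summits.HodgeConjecture.HodgeConjecture.Theses.CyclicUnitaryPowers
import Summits.HodgeConjecture.HodgeConjecture.Theorems.CyclicUnitaryPowersNodalMeridianMonodromy
import HarnessLib

/-!
# Route A item `CyclicUnitaryPowers.NodalMeridianLocalMonodromyBound` (stmt-HodgeConjecture-23151) — closed by
# transcription of prover-Ax's landed theorem p658190 (F1‡).

Prover seat `hodge-nonav-prover-Ax` (g11), cell `hodge-nonav`; statement drafted by the tenure planner (hodge-nonav-p3 g34).
The item's statement is the named fact `carlsonToledo1999_nodalMeridianLocalMonodromyBound` (Carlson–Toledo 1999 §6, the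
nodal-meridian local-monodromy bound for the `p`-cyclic covers `x₃^p = f`), which is a THEOREM of the tree
(`carlsonToledo1999_nodalMeridianLocalMonodromyBound_holds`, programme "localisation").  Nothing here says HC ∕ HC_AV is proved.

## References

* [CarlsonToledo1999] J. A. Carlson, D. Toledo, Discriminant complements and kernels of monodromy representations,
  Duke Math. J. 97 (1999), §6.
-/

set_option linter.dupNamespace false

namespace Summit.HodgeConjecture.HodgeConjecture.Theorems.CyclicUnitaryPowersNodalMeridianLocalMonodromyBoundItem

/-- item stmt-HodgeConjecture-23151 (split child of K1-A): the Carlson–Toledo nodal-meridian local monodromy bound,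
proved by `CyclicUnitaryPowersNodalMeridianMonodromy.carlsonToledo1999_nodalMeridianLocalMonodromyBound_holds`. -/
theorem nodalMeridianLocalMonodromyBound_holds :
    Summit.HodgeConjecture.HodgeConjecture.Theses.CyclicUnitaryPowers.NodalMeridianLocalMonodromyBound :=
  Summit.HodgeConjecture.HodgeConjecture.Theorems.CyclicUnitaryPowersNodalMeridianMonodromy.carlsonToledo1999_nodalMeridianLocalMonodromyBound_holds

end Summit.HodgeConjecture.HodgeConjecture.Theorems.CyclicUnitaryPowersNodalMeridianLocalMonodromyBoundItem
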